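import Mathlib.Analysis.SpecialFunctions.Pow.Real
import Mathlib.Analysis.Complex.Basic
import HarnessLib

/-!
# The Stechkin-type inequality for the far zeros in Kadiri's method (Acta Arith. 117 (2005), (3.11), Lemma 4.1)

Topic `Literature/NumberTheory/LFunctions`. Everything in this file is PROVED (no named fact, no
definition). In the proof of Kadiri's Prop. 4.4 (the zeros `ρ = β + iγ` with `y_k = |kγ₀ − γ| ≥ t₀`)
the main term of the pair `D(σ−β+iy) + D(σ−1+β+iy)` is

  `g₁ η · Re{ 1/(σ−β+iy) + 1/(σ−1+β+iy) − κ/(σ−β+δ+iy) − κ/(σ−1+β+δ+iy) }`,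

and Kadiri states ((3.11) and the sentence after it) that "le terme général de la première somme est
positif puisque `δ ≥ (√5−1)/2`, d'après le lemme de Stechkin (cf. lemme 2, [Stechkin1])". We prove
the quantitative form that is actually used for `y ≥ t₀` large: with `x₁ = σ − β`, `x₂ = σ − 1 + β`,

  `Re{…} ≥ ((x₁ + x₂)(1 − κ) − 2κδ)/y² − 18/y⁴`   (`|x₁|, |x₂| ≤ 1`, `0 ≤ δ ≤ 1`, `0 ≤ κ ≤ 1`, `y ≠ 0`),

from the identity `x/(x²+y²) = x/y² − x³/(y²(x²+y²))` and `|x³/(x²+y²)| ≤ |x|³/y²`; hence the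
real part is `≥ 0` as soon as `(2σ−1)(1−κ) − 2κδ ≥ 18/y²` (`x₁ + x₂ = 2σ − 1`), in particular for
`y ≥ t₀` with `t₀² ((2σ−1)(1−κ) − 2κδ) ≥ 18` — amply satisfied by the parameters of Kadiri,
Mossinghoff–Trudgian and Mossinghoff–Trudgian–Yang (`t₀ = 10⁵`, `κ ≈ 0.44`, `δ ≈ 0.62`).

* `Literature.NumberTheory.LFunctions.KadiriStechkin.re_inv_eq`, `re_inv_ge`, `re_inv_le`;
* `Literature.NumberTheory.LFunctions.KadiriStechkin.fourTerm_ge` — the displayed inequality;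
* `Literature.NumberTheory.LFunctions.KadiriStechkin.fourTerm_nonneg` — positivity for `y² A ≥ 18`;
* `Literature.NumberTheory.LFunctions.KadiriStechkin.fourTerm_nonneg_of_ratio(_ge)` — the exact
  ratio form (Stechkin's mechanism `a(p+Y)/D − κ(a+2δ)(p_δ+Y)/D_δ`, `D ≤ D_δ`): positivity for all
  `|y| ≥ y₀` from the linear condition `κ(a+2δ)(p₀ + aδ + δ² + y₀²) ≤ a(p₀ + y₀²)`.

## References

* H. Kadiri, *Une région explicite sans zéros pour la fonction ζ de Riemann*, Acta Arith. 117
  (2005) = arXiv:math/0401238, (3.11) and the remark following it, Lemma 4.1. (`Kadiri2005`)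
-/

noncomputable section

open Complex Real

namespace Literature.NumberTheory.LFunctions

namespace KadiriStechkin

/-- `Re 1/(x + iy) = x/(x² + y²)`. [folklore] -/
theorem re_inv_eq (x y : ℝ) : (1 / ((x : ℂ) + y * I)).re = x / (x ^ 2 + y ^ 2) := by
  rw [one_div, Complex.inv_re, Complex.normSq_apply]
  simp
  ring_nf

/-- The second-order expansion: `x/(x²+y²) = x/y² − x³/(y²(x²+y²))` (`y ≠ 0`). [folklore] -/
theorem main_identity {x y : ℝ} (hy : y ≠ 0) :
    x / (x ^ 2 + y ^ 2) = x / y ^ 2 - x ^ 3 / (y ^ 2 * (x ^ 2 + y ^ 2)) := by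
  have hy2 : y ^ 2 ≠ 0 := pow_ne_zero 2 hy
  have hxy : x ^ 2 + y ^ 2 ≠ 0 := by positivity
  field_simp
  ring

/-- `|x³/(y²(x²+y²))| ≤ |x|³/y⁴` (`y ≠ 0`). [folklore] -/
theorem abs_error_le {x y : ℝ} (hy : y ≠ 0) :
    |x ^ 3 / (y ^ 2 * (x ^ 2 + y ^ 2))| ≤ |x| ^ 3 / y ^ 4 := by
  have hy2 : 0 < y ^ 2 := by positivity
  have hy4 : 0 < y ^ 4 := by positivity
  rw [abs_div, abs_mul, abs_of_pos hy2, abs_of_pos (by positivity : 0 < x ^ 2 + y ^ 2), abs_pow,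
    div_le_div_iff₀ (by positivity) hy4]
  have h1 : |x| ^ 3 * (y ^ 2 * (x ^ 2 + y ^ 2)) - |x| ^ 3 * y ^ 4 = |x| ^ 3 * y ^ 2 * x ^ 2 := by ring
  nlinarith [abs_nonneg x, pow_nonneg (abs_nonneg x) 3, sq_nonneg x,
    mul_nonneg (mul_nonneg (pow_nonneg (abs_nonneg x) 3) hy2.le) (sq_nonneg x)]

/-- Lower bound: `x/(x²+y²) ≥ x/y² − |x|³/y⁴`. [folklore] -/
theorem re_inv_ge {x y : ℝ} (hy : y ≠ 0) : x / y ^ 2 - |x| ^ 3 / y ^ 4 ≤ x / (x ^ 2 + y ^ 2) := by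
  rw [main_identity hy]
  have := (abs_le.1 (abs_error_le (x := x) hy)).2
  linarith

/-- Upper bound: `x/(x²+y²) ≤ x/y² + |x|³/y⁴`. [folklore] -/
theorem re_inv_le {x y : ℝ} (hy : y ≠ 0) : x / (x ^ 2 + y ^ 2) ≤ x / y ^ 2 + |x| ^ 3 / y ^ 4 := by
  rw [main_identity hy]
  have := (abs_le.1 (abs_error_le (x := x) hy)).1
  linarith

/-- `|x| ≤ 1 → |x|³ ≤ 1`, `|x| ≤ 1, 0 ≤ δ ≤ 1 → |x + δ|³ ≤ 8`. [folklore] -/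
theorem cube_bounds {x δ : ℝ} (hx : |x| ≤ 1) (hδ0 : 0 ≤ δ) (hδ1 : δ ≤ 1) :
    |x| ^ 3 ≤ 1 ∧ |x + δ| ^ 3 ≤ 8 := by
  constructor
  · calc |x| ^ 3 ≤ 1 ^ 3 := pow_le_pow_left₀ (abs_nonneg _) hx 3
      _ = 1 := by norm_num
  · have h : |x + δ| ≤ 2 := (abs_add_le _ _).trans (by rw [abs_of_nonneg hδ0]; linarith)
    calc |x + δ| ^ 3 ≤ 2 ^ 3 := pow_le_pow_left₀ (abs_nonneg _) h 3
      _ = 8 := by norm_num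

/-- **The Stechkin-type four-term inequality, quantitative form** (main term of Kadiri's (3.11)):
for `|x₁|, |x₂| ≤ 1`, `0 ≤ δ ≤ 1`, `0 ≤ κ ≤ 1`, `y ≠ 0`,
`Re{1/(x₁+iy) + 1/(x₂+iy) − κ/(x₁+δ+iy) − κ/(x₂+δ+iy)} ≥ ((x₁+x₂)(1−κ) − 2κδ)/y² − 18/y⁴`.
[cite: Kadiri2005, (3.11)] -/
theorem fourTerm_ge {x₁ x₂ δ κ y : ℝ} (hx₁ : |x₁| ≤ 1) (hx₂ : |x₂| ≤ 1) (hδ0 : 0 ≤ δ) (hδ1 : δ ≤ 1)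
    (hκ0 : 0 ≤ κ) (hκ1 : κ ≤ 1) (hy : y ≠ 0) :
    ((x₁ + x₂) * (1 - κ) - 2 * κ * δ) / y ^ 2 - 18 / y ^ 4 ≤
      (1 / ((x₁ : ℂ) + y * I)).re + (1 / ((x₂ : ℂ) + y * I)).re -
        κ * ((1 / (((x₁ + δ : ℝ) : ℂ) + y * I)).re + (1 / (((x₂ + δ : ℝ) : ℂ) + y * I)).re) := by
  simp only [re_inv_eq]
  have hy4 : 0 < y ^ 4 := by positivity
  have hy2 : 0 < y ^ 2 := by positivity
  have h1 := re_inv_ge (x := x₁) hy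
  have h2 := re_inv_ge (x := x₂) hy
  have h3 := re_inv_le (x := x₁ + δ) hy
  have h4 := re_inv_le (x := x₂ + δ) hy
  obtain ⟨c1, c3⟩ := cube_bounds hx₁ hδ0 hδ1
  obtain ⟨c2, c4⟩ := cube_bounds hx₂ hδ0 hδ1
  -- the error budget: `1 + 1 + 8κ + 8κ ≤ 18`
  have e1 : |x₁| ^ 3 / y ^ 4 ≤ 1 / y ^ 4 := div_le_div_of_nonneg_right c1 hy4.le
  have e2 : |x₂| ^ 3 / y ^ 4 ≤ 1 / y ^ 4 := div_le_div_of_nonneg_right c2 hy4.le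
  have e3 : κ * (|x₁ + δ| ^ 3 / y ^ 4) ≤ 8 / y ^ 4 := by
    calc κ * (|x₁ + δ| ^ 3 / y ^ 4) ≤ 1 * (8 / y ^ 4) :=
          mul_le_mul hκ1 (div_le_div_of_nonneg_right c3 hy4.le) (by positivity) zero_le_one
      _ = 8 / y ^ 4 := one_mul _
  have e4 : κ * (|x₂ + δ| ^ 3 / y ^ 4) ≤ 8 / y ^ 4 := by
    calc κ * (|x₂ + δ| ^ 3 / y ^ 4) ≤ 1 * (8 / y ^ 4) :=
          mul_le_mul hκ1 (div_le_div_of_nonneg_right c4 hy4.le) (by positivity) zero_le_one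
      _ = 8 / y ^ 4 := one_mul _
  have hk3 : κ * ((x₁ + δ) / ((x₁ + δ) ^ 2 + y ^ 2)) ≤ κ * ((x₁ + δ) / y ^ 2 + |x₁ + δ| ^ 3 / y ^ 4) :=
    mul_le_mul_of_nonneg_left h3 hκ0
  have hk4 : κ * ((x₂ + δ) / ((x₂ + δ) ^ 2 + y ^ 2)) ≤ κ * ((x₂ + δ) / y ^ 2 + |x₂ + δ| ^ 3 / y ^ 4) :=
    mul_le_mul_of_nonneg_left h4 hκ0
  have emain : ((x₁ + x₂) * (1 - κ) - 2 * κ * δ) / y ^ 2 =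
      x₁ / y ^ 2 + x₂ / y ^ 2 - κ * ((x₁ + δ) / y ^ 2) - κ * ((x₂ + δ) / y ^ 2) := by
    field_simp
    ring
  have e18 : (18 : ℝ) / y ^ 4 = 1 / y ^ 4 + 1 / y ^ 4 + 8 / y ^ 4 + 8 / y ^ 4 := by ring
  rw [emain, e18]
  linarith

/-- **Positivity of the far-zero main term**: under the hypotheses of `fourTerm_ge`, if
`y² ((x₁+x₂)(1−κ) − 2κδ) ≥ 18` then the four-term real part is `≥ 0` (Kadiri: "le terme général
de la première somme est positif"). [cite: Kadiri2005, (3.11)] -/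
theorem fourTerm_nonneg {x₁ x₂ δ κ y : ℝ} (hx₁ : |x₁| ≤ 1) (hx₂ : |x₂| ≤ 1) (hδ0 : 0 ≤ δ)
    (hδ1 : δ ≤ 1) (hκ0 : 0 ≤ κ) (hκ1 : κ ≤ 1) (hy : y ≠ 0)
    (hbig : 18 ≤ y ^ 2 * ((x₁ + x₂) * (1 - κ) - 2 * κ * δ)) :
    0 ≤ (1 / ((x₁ : ℂ) + y * I)).re + (1 / ((x₂ : ℂ) + y * I)).re -
        κ * ((1 / (((x₁ + δ : ℝ) : ℂ) + y * I)).re + (1 / (((x₂ + δ : ℝ) : ℂ) + y * I)).re) := by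
  refine le_trans ?_ (fourTerm_ge hx₁ hx₂ hδ0 hδ1 hκ0 hκ1 hy)
  have hy2 : 0 < y ^ 2 := by positivity
  have hy4 : 0 < y ^ 4 := by positivity
  rw [sub_nonneg, div_le_div_iff₀ hy4 hy2]
  nlinarith

/-! ## The exact ratio form (Stechkin's mechanism): positivity for all `y ≥ y₀` -/

/-- The pair identity behind Stechkin's lemma:
`x₁/(x₁²+Y) + x₂/(x₂²+Y) = (x₁+x₂)(x₁x₂+Y)/((x₁²+Y)(x₂²+Y))` (`Y ≥ 0`, denominators `≠ 0`).
[cite: Kadiri2005, Lemma 4.1] -/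
theorem pair_eq {x₁ x₂ Y : ℝ} (h₁ : x₁ ^ 2 + Y ≠ 0) (h₂ : x₂ ^ 2 + Y ≠ 0) :
    x₁ / (x₁ ^ 2 + Y) + x₂ / (x₂ ^ 2 + Y) =
      (x₁ + x₂) * (x₁ * x₂ + Y) / ((x₁ ^ 2 + Y) * (x₂ ^ 2 + Y)) := by
  field_simp
  ring

/-- **Stechkin-type positivity, exact ratio form.** Let `x₁ + x₂ = a > 0`, `x₁, x₂ ≥ −δ/2`,
`δ ≥ 0`, `κ ≥ 0`, `y ≠ 0` with `x₁x₂ + y² > 0`. If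
`κ (a + 2δ)((x₁+δ)(x₂+δ) + y²) ≤ a (x₁x₂ + y²)` then
`Re{1/(x₁+iy) + 1/(x₂+iy) − κ/(x₁+δ+iy) − κ/(x₂+δ+iy)} ≥ 0`
(the two pairs are `a(p+Y)/D` and `κ(a+2δ)(p_δ+Y)/D_δ` with `D ≤ D_δ`). This is the mechanism of
Stechkin's Lemma as used by Kadiri ("positif puisque `δ ≥ (√5−1)/2`"), with the hypothesis in the
checkable form; it is linear increasing in `Y = y²` when `κ(a+2δ) ≤ a`, so it suffices to check
it at `y = y₀` (`fourTerm_nonneg_of_ratio_ge`). [cite: Kadiri2005, Lemma 4.1, (3.11)] -/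
theorem fourTerm_nonneg_of_ratio {x₁ x₂ δ κ y : ℝ} (ha : 0 < x₁ + x₂) (hx₁ : -(δ / 2) ≤ x₁)
    (hx₂ : -(δ / 2) ≤ x₂) (hδ : 0 ≤ δ) (hκ : 0 ≤ κ) (hy : y ≠ 0) (hp : 0 < x₁ * x₂ + y ^ 2)
    (hcond : κ * (x₁ + x₂ + 2 * δ) * ((x₁ + δ) * (x₂ + δ) + y ^ 2) ≤ (x₁ + x₂) * (x₁ * x₂ + y ^ 2)) :
    0 ≤ (1 / ((x₁ : ℂ) + y * I)).re + (1 / ((x₂ : ℂ) + y * I)).re -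
        κ * ((1 / (((x₁ + δ : ℝ) : ℂ) + y * I)).re + (1 / (((x₂ + δ : ℝ) : ℂ) + y * I)).re) := by
  simp only [re_inv_eq]
  have hy2 : 0 < y ^ 2 := by positivity
  have hD₁ : 0 < x₁ ^ 2 + y ^ 2 := by positivity
  have hD₂ : 0 < x₂ ^ 2 + y ^ 2 := by positivity
  have hE₁ : 0 < (x₁ + δ) ^ 2 + y ^ 2 := by positivity
  have hE₂ : 0 < (x₂ + δ) ^ 2 + y ^ 2 := by positivity
  rw [pair_eq hD₁.ne' hD₂.ne', pair_eq hE₁.ne' hE₂.ne']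
  -- `D ≤ D_δ`
  have hle₁ : x₁ ^ 2 + y ^ 2 ≤ (x₁ + δ) ^ 2 + y ^ 2 := by nlinarith
  have hle₂ : x₂ ^ 2 + y ^ 2 ≤ (x₂ + δ) ^ 2 + y ^ 2 := by nlinarith
  have hDD : (x₁ ^ 2 + y ^ 2) * (x₂ ^ 2 + y ^ 2) ≤ ((x₁ + δ) ^ 2 + y ^ 2) * ((x₂ + δ) ^ 2 + y ^ 2) :=
    mul_le_mul hle₁ hle₂ hD₂.le hE₁.le
  have hpδ : 0 ≤ (x₁ + δ) * (x₂ + δ) + y ^ 2 := by nlinarith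
  have hnum : 0 ≤ (x₁ + x₂ + 2 * δ) * ((x₁ + δ) * (x₂ + δ) + y ^ 2) := by positivity
  -- the shifted pair is at most `κ (a+2δ)(p_δ + Y)/D`
  have h1 : κ * ((x₁ + δ + (x₂ + δ)) * ((x₁ + δ) * (x₂ + δ) + y ^ 2) /
      (((x₁ + δ) ^ 2 + y ^ 2) * ((x₂ + δ) ^ 2 + y ^ 2))) ≤
      κ * ((x₁ + x₂ + 2 * δ) * ((x₁ + δ) * (x₂ + δ) + y ^ 2) / ((x₁ ^ 2 + y ^ 2) * (x₂ ^ 2 + y ^ 2))) := by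
    refine mul_le_mul_of_nonneg_left ?_ hκ
    rw [show x₁ + δ + (x₂ + δ) = x₁ + x₂ + 2 * δ by ring]
    exact div_le_div_of_nonneg_left hnum (by positivity) hDD
  have h2 : κ * ((x₁ + x₂ + 2 * δ) * ((x₁ + δ) * (x₂ + δ) + y ^ 2) / ((x₁ ^ 2 + y ^ 2) * (x₂ ^ 2 + y ^ 2)))
      ≤ (x₁ + x₂) * (x₁ * x₂ + y ^ 2) / ((x₁ ^ 2 + y ^ 2) * (x₂ ^ 2 + y ^ 2)) := by
    rw [← mul_div_assoc, div_le_div_iff_of_pos_right (by positivity)]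
    linarith
  linarith

/-- The ratio condition is increasing in `Y = y²` when `κ(a + 2δ) ≤ a`: if it holds at `y₀` it holds
for all `|y| ≥ y₀`. [folklore] -/
theorem ratio_cond_mono {x₁ x₂ δ κ y₀ y : ℝ} (hA : κ * (x₁ + x₂ + 2 * δ) ≤ x₁ + x₂)
    (h0 : κ * (x₁ + x₂ + 2 * δ) * ((x₁ + δ) * (x₂ + δ) + y₀ ^ 2) ≤ (x₁ + x₂) * (x₁ * x₂ + y₀ ^ 2))
    (hy : y₀ ^ 2 ≤ y ^ 2) :
    κ * (x₁ + x₂ + 2 * δ) * ((x₁ + δ) * (x₂ + δ) + y ^ 2) ≤ (x₁ + x₂) * (x₁ * x₂ + y ^ 2) := by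
  nlinarith [mul_le_mul_of_nonneg_right hA (sub_nonneg.2 hy)]

/-- The ratio condition is increasing in `p = x₁x₂` when `κ(a + 2δ) ≤ a` (for fixed `a = x₁ + x₂`):
it suffices to check it at a lower bound `p₀ ≤ x₁x₂`, in the form
`κ(a+2δ)(p₀ + aδ + δ² + Y) ≤ a(p₀ + Y)`. [folklore] -/
theorem ratio_cond_of_le_prod {x₁ x₂ δ κ y p₀ : ℝ} (hA : κ * (x₁ + x₂ + 2 * δ) ≤ x₁ + x₂)
    (hp : p₀ ≤ x₁ * x₂)
    (h0 : κ * (x₁ + x₂ + 2 * δ) * (p₀ + (x₁ + x₂) * δ + δ ^ 2 + y ^ 2) ≤ (x₁ + x₂) * (p₀ + y ^ 2)) :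
    κ * (x₁ + x₂ + 2 * δ) * ((x₁ + δ) * (x₂ + δ) + y ^ 2) ≤ (x₁ + x₂) * (x₁ * x₂ + y ^ 2) := by
  have e : (x₁ + δ) * (x₂ + δ) + y ^ 2 = x₁ * x₂ + (x₁ + x₂) * δ + δ ^ 2 + y ^ 2 := by ring
  rw [e]
  nlinarith [mul_le_mul_of_nonneg_right hA (sub_nonneg.2 hp)]

/-- **Positivity for all `|y| ≥ y₀`, from the condition at `(p₀, y₀)`** (the form used per round:
`a = 2σ − 1`, `p₀ = −σ(1−σ)` the minimum of `(σ−β)(σ−1+β)` over `β ∈ [0,1]`).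
[cite: Kadiri2005, Lemma 4.1, (3.11)] -/
theorem fourTerm_nonneg_of_ratio_ge {x₁ x₂ δ κ y y₀ p₀ : ℝ} (ha : 0 < x₁ + x₂) (hx₁ : -(δ / 2) ≤ x₁)
    (hx₂ : -(δ / 2) ≤ x₂) (hδ : 0 ≤ δ) (hκ : 0 ≤ κ) (hy₀ : 0 < y₀) (hy : y₀ ≤ |y|)
    (hp : p₀ ≤ x₁ * x₂) (hp₀ : 0 < p₀ + y₀ ^ 2) (hA : κ * (x₁ + x₂ + 2 * δ) ≤ x₁ + x₂)
    (h0 : κ * (x₁ + x₂ + 2 * δ) * (p₀ + (x₁ + x₂) * δ + δ ^ 2 + y₀ ^ 2) ≤ (x₁ + x₂) * (p₀ + y₀ ^ 2)) :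
    0 ≤ (1 / ((x₁ : ℂ) + y * I)).re + (1 / ((x₂ : ℂ) + y * I)).re -
        κ * ((1 / (((x₁ + δ : ℝ) : ℂ) + y * I)).re + (1 / (((x₂ + δ : ℝ) : ℂ) + y * I)).re) := by
  have hyy : y₀ ^ 2 ≤ y ^ 2 := by
    rw [← sq_abs y]; exact pow_le_pow_left₀ hy₀.le hy 2
  have hy0 : y ≠ 0 := fun h ↦ by rw [h, abs_zero] at hy; linarith
  refine fourTerm_nonneg_of_ratio ha hx₁ hx₂ hδ hκ hy0 (by nlinarith) ?_
  have h1 : κ * (x₁ + x₂ + 2 * δ) * (p₀ + (x₁ + x₂) * δ + δ ^ 2 + y ^ 2) ≤ (x₁ + x₂) * (p₀ + y ^ 2) := by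
    nlinarith [mul_le_mul_of_nonneg_right hA (sub_nonneg.2 hyy)]
  exact ratio_cond_of_le_prod hA hp h1

end KadiriStechkin

end Literature.NumberTheory.LFunctions
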